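import Literature.NumberTheory.DiophantineGeometry.MinimalModelUniquenessProofs
import HarnessLib

/-!
# X11b at `p = 3` (team N8/O2), JET3-KUMMER: non-minimality witnesses of a Weierstrass equation
# over a discrete valuation ring — one coset, stable under automorphisms (S15 (ix), part 18)

HONEST FRAMING (cell `b2b-bsdres`, run/shared/lean/b2b/bsd-rank1-residual/, verbatim in every
file): the goal of the cell is to DELETE the COMBINATION-SHAPED residual classes of the
Birch–Swinnerton-Dyer formula for ALL analytic-rank `≤ 1` elliptic curves over `ℚ` — "full BSD
formula for every rank `≤ 1` curve in class `C`" assembled STRICTLY from published theorems — so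
that the rank-`≤ 1` remainder becomes exactly the CONSTRUCTION-SHAPED classes, which are TYPED
(missing-input `Prop`s), NOT attempted. This is not "finishing BSD". Team N8/O2 = `x11b3`, seat
`b2b-bsdres-x11b3-p4` (provider of record at additive places), S15 (ix) part 18 (lead R7-57).
THEOREMS ONLY: no definition, no named fact, no `sorry`; nothing is booked; `JET@p|N` is NOT
discharged.

## What

Pure local algebra over a discrete valuation ring `R` with a uniformiser `ϖ` and an `R`-model `M`
(the engine of part 19 `UnramifiedMinimalDescent`, Silverman *AEC* VII.5.4 (a) over the S15 layer
by Galois descent). A NON-MINIMALITY WITNESS of `M` is `(r, s, t) ∈ R³` with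
`ϖⁱ ∣ aᵢ((1; r, s, t) • M)` for `i = 1, 2, 3, 4, 6` (then `(x, y) ↦ (ϖ²x + r, ϖ³y + ϖ²sx + t)`
is an integral equation with `v(Δ)` smaller by `12`, *ATAEC* IV.9.4 Step 11). The predicate is
spelled out as five divisibility hypotheses (no `def`).

* `isIntegral_scale_smul_map` — the `ϖ`-scaled translate of a witness is `R`-integral (the
  tree's `not_isMinimal_of_pow_dvd` computation for an arbitrary uniformiser);
* **`dvd_sub_of_witness`** — THE WITNESSES FORM ONE COSET (uniqueness of the classes): two
  witnesses satisfy `ϖ² ∣ r′ − r`, `ϖ ∣ s′ − s`, `ϖ³ ∣ t′ − t − s (r′ − r)`, because the two scaled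
  models are integral and differ by `(1; (r′−r)/ϖ², (s′−s)/ϖ, (t′−t−s(r′−r))/ϖ³)`, whose entries
  are integral by Silverman *AEC* VII.1.3 (b) (tree `valuation_r/s/t_le_one_of_isIntegral`,
  `MinimalModelUniquenessProofs`);
* **`witness_move`** — conversely `(r + ϖ²ρ, s + ϖσ, t + sϖ²ρ + ϖ³τ)` is a witness for all
  `ρ, σ, τ ∈ R` (transformation formulas, *AEC* III.1 Table 3.1);
* **`witness_map`** — a ring automorphism `e` of `R` fixing the coefficients of `M` and `ϖ` maps
  witnesses to witnesses (`aᵢ((1; e r, e s, e t) • M) = e (aᵢ((1; r, s, t) • M))`).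

References (locators only; no new fact): [cite: SilvermanAEC2009, VII.1 Prop. 1.3 (b)
(PDF p. 165), III.1 Table 3.1] [cite: SilvermanATAEC1994, IV.9.4 Step 11].

## Design

No definitions; `noncomputable section`; `open scoped Classical`; universe `u` for the fraction
field `L` of `isIntegral_scale_smul_map`; `dvd_sub_of_witness` works in `FractionRing R`
internally. Axioms: `propext`, `Classical.choice`, `Quot.sound`.
-/

noncomputable section

open scoped Classical

namespace Summit.BirchSwinnertonDyer.Rank1Residual.X11b.Three.JetchevKummer

open WeierstrassCurve IsDiscreteValuationRing IsDedekindDomain.HeightOneSpectrum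

universe u

/-! ### §1 Non-minimality witnesses over a discrete valuation ring -/

section Witness

variable (L : Type u) [Field L]
  (R : Type*) [CommRing R] [IsDomain R] [IsDiscreteValuationRing R] [Algebra R L]
  [IsFractionRing R L]

omit [IsDomain R] [IsDiscreteValuationRing R] [IsFractionRing R L] in
/-- **The scaled model of a witness is integral.** If the `R`-model `D • M` has `ϖⁱ ∣ aᵢ`
(`i = 1, 2, 3, 4, 6`), then `(x, y) ↦ (ϖ² x, ϖ³ y)` applied to `D • M` over `L = Frac R` is again
`R`-integral (Silverman, *ATAEC* IV.9.4 Step 11; the tree's `not_isMinimal_of_pow_dvd` computation,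
for an arbitrary `ϖ`). [cite: SilvermanATAEC1994, IV.9.4 Step 11] -/
theorem isIntegral_scale_smul_map (M : WeierstrassCurve R) {ϖ : R}
    (hϖ0 : algebraMap R L ϖ ≠ 0) (D : VariableChange R)
    (h1 : ϖ ∣ (D • M).a₁) (h2 : ϖ ^ 2 ∣ (D • M).a₂) (h3 : ϖ ^ 3 ∣ (D • M).a₃)
    (h4 : ϖ ^ 4 ∣ (D • M).a₄) (h6 : ϖ ^ 6 ∣ (D • M).a₆) :
    ((⟨Units.mk0 (algebraMap R L ϖ) hϖ0, 0, 0, 0⟩ : VariableChange L) •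
      (D • M).map (algebraMap R L)).IsIntegral R := by
  obtain ⟨c₁, hc₁⟩ := h1
  obtain ⟨c₂, hc₂⟩ := h2
  obtain ⟨c₃, hc₃⟩ := h3
  obtain ⟨c₄, hc₄⟩ := h4
  obtain ⟨c₆, hc₆⟩ := h6
  have hp0 := hϖ0
  set S : VariableChange L := ⟨Units.mk0 _ hϖ0, 0, 0, 0⟩ with hS
  apply WeierstrassCurve.isIntegral_of_exists_lift R
  · refine ⟨c₁, ?_⟩
    simp only [hS, WeierstrassCurve.variableChange_a₁, WeierstrassCurve.map_a₁, hc₁, map_mul,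
      Units.val_inv_eq_inv_val, Units.val_mk0, mul_zero, add_zero, inv_mul_cancel_left₀ hp0]
  · refine ⟨c₂, ?_⟩
    simp only [hS, WeierstrassCurve.variableChange_a₂, WeierstrassCurve.map_a₂,
      WeierstrassCurve.map_a₁, hc₂, map_mul, map_pow, Units.val_inv_eq_inv_val, Units.val_mk0,
      mul_zero, zero_mul, sub_zero, add_zero, ne_eq, OfNat.ofNat_ne_zero, not_false_eq_true,
      zero_pow, inv_pow, inv_mul_cancel_left₀ (pow_ne_zero 2 hp0)]
  · refine ⟨c₃, ?_⟩
    simp only [hS, WeierstrassCurve.variableChange_a₃, WeierstrassCurve.map_a₃,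
      WeierstrassCurve.map_a₁, hc₃, map_mul, map_pow, Units.val_inv_eq_inv_val, Units.val_mk0,
      mul_zero, zero_mul, add_zero, inv_pow, inv_mul_cancel_left₀ (pow_ne_zero 3 hp0)]
  · refine ⟨c₄, ?_⟩
    simp only [hS, WeierstrassCurve.variableChange_a₄, WeierstrassCurve.map_a₄,
      WeierstrassCurve.map_a₁, WeierstrassCurve.map_a₂, WeierstrassCurve.map_a₃, hc₄, map_mul,
      map_pow, Units.val_inv_eq_inv_val, Units.val_mk0, mul_zero, zero_mul, sub_zero, add_zero,
      ne_eq, OfNat.ofNat_ne_zero, not_false_eq_true, zero_pow, inv_pow,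
      inv_mul_cancel_left₀ (pow_ne_zero 4 hp0)]
  · refine ⟨c₆, ?_⟩
    simp only [hS, WeierstrassCurve.variableChange_a₆, WeierstrassCurve.map_a₆,
      WeierstrassCurve.map_a₁, WeierstrassCurve.map_a₂, WeierstrassCurve.map_a₃,
      WeierstrassCurve.map_a₄, hc₆, map_mul, map_pow, Units.val_inv_eq_inv_val, Units.val_mk0,
      mul_zero, zero_mul, sub_zero, add_zero, ne_eq, OfNat.ofNat_ne_zero, not_false_eq_true,
      zero_pow, inv_pow, inv_mul_cancel_left₀ (pow_ne_zero 6 hp0)]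

/-- **The witnesses form one coset: uniqueness of the classes.** If `(r, s, t)` and `(r', s', t')`
are both non-minimality witnesses of the `R`-model `M` (`ϖⁱ ∣ aᵢ((1; r, s, t) • M)` for
`i = 1, 2, 3, 4, 6`), then `ϖ² ∣ r' − r`, `ϖ ∣ s' − s`, `ϖ³ ∣ t' − t − s (r' − r)`: the two scaled
models are `R`-integral and differ by the change `(1; (r'−r)/ϖ², (s'−s)/ϖ, (t'−t−s(r'−r))/ϖ³)`,
whose entries are integral by Silverman, *AEC* VII.1.3 (b) (tree
`valuation_r/s/t_le_one_of_isIntegral`). [cite: SilvermanAEC2009, VII.1 Prop. 1.3 (b) (PDF p. 165)] -/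
theorem dvd_sub_of_witness (M : WeierstrassCurve R) {ϖ : R} (hϖ : Irreducible ϖ)
    {r s t r' s' t' : R}
    (h1 : ϖ ∣ ((⟨1, r, s, t⟩ : VariableChange R) • M).a₁)
    (h2 : ϖ ^ 2 ∣ ((⟨1, r, s, t⟩ : VariableChange R) • M).a₂)
    (h3 : ϖ ^ 3 ∣ ((⟨1, r, s, t⟩ : VariableChange R) • M).a₃)
    (h4 : ϖ ^ 4 ∣ ((⟨1, r, s, t⟩ : VariableChange R) • M).a₄)
    (h6 : ϖ ^ 6 ∣ ((⟨1, r, s, t⟩ : VariableChange R) • M).a₆)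
    (h1' : ϖ ∣ ((⟨1, r', s', t'⟩ : VariableChange R) • M).a₁)
    (h2' : ϖ ^ 2 ∣ ((⟨1, r', s', t'⟩ : VariableChange R) • M).a₂)
    (h3' : ϖ ^ 3 ∣ ((⟨1, r', s', t'⟩ : VariableChange R) • M).a₃)
    (h4' : ϖ ^ 4 ∣ ((⟨1, r', s', t'⟩ : VariableChange R) • M).a₄)
    (h6' : ϖ ^ 6 ∣ ((⟨1, r', s', t'⟩ : VariableChange R) • M).a₆) :
    ϖ ^ 2 ∣ r' - r ∧ ϖ ∣ s' - s ∧ ϖ ^ 3 ∣ t' - t - s * (r' - r) := by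
  have hinj : Function.Injective (algebraMap R (FractionRing R)) :=
    IsFractionRing.injective R (FractionRing R)
  have hϖ0 : algebraMap R (FractionRing R) ϖ ≠ 0 := (map_ne_zero_iff _ hinj).mpr hϖ.ne_zero
  set p : (FractionRing R)ˣ := Units.mk0 (algebraMap R (FractionRing R) ϖ) hϖ0 with hp
  set S : VariableChange (FractionRing R) := ⟨p, 0, 0, 0⟩ with hS
  set τ : VariableChange R := ⟨1, r, s, t⟩ with hτ
  set τ' : VariableChange R := ⟨1, r', s', t'⟩ with hτ'
  haveI hW₁ : (S • (τ • M).map (algebraMap R (FractionRing R))).IsIntegral R :=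
    isIntegral_scale_smul_map (FractionRing R) R M hϖ0 τ h1 h2 h3 h4 h6
  haveI hW₂ : (S • (τ' • M).map (algebraMap R (FractionRing R))).IsIntegral R :=
    isIntegral_scale_smul_map (FractionRing R) R M hϖ0 τ' h1' h2' h3' h4' h6'
  -- the relative change of variables
  set D : VariableChange (FractionRing R) :=
    S * τ'.map (algebraMap R (FractionRing R)) * (τ.map (algebraMap R (FractionRing R)))⁻¹ * S⁻¹
    with hD
  have hrel : S • (τ' • M).map (algebraMap R (FractionRing R)) =
      D • (S • (τ • M).map (algebraMap R (FractionRing R))) := by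
    rw [← map_variableChange, ← map_variableChange, smul_smul, smul_smul, smul_smul, hD]
    congr 1
    simp only [mul_assoc, inv_mul_cancel, mul_one]
  have hDu : (D.u : FractionRing R) = 1 := by
    rw [hD, hS, hτ, hτ']
    simp [VariableChange.mul_def, VariableChange.inv_def, VariableChange.map]
  have hDu' : valuation (FractionRing R) (maximalIdeal R) (D.u : FractionRing R) = 1 := by
    rw [hDu, map_one]
  have hDr : D.r = algebraMap R (FractionRing R) (r' - r) *
      (algebraMap R (FractionRing R) ϖ)⁻¹ ^ 2 := by
    rw [hD, hS, hτ, hτ', hp]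
    simp only [VariableChange.mul_def, VariableChange.inv_def, VariableChange.map,
      Units.val_mk0, Units.val_inv_eq_inv_val, Units.val_one, map_one, map_sub, inv_one]
    ring
  have hDs : D.s = algebraMap R (FractionRing R) (s' - s) *
      (algebraMap R (FractionRing R) ϖ)⁻¹ := by
    rw [hD, hS, hτ, hτ', hp]
    simp only [VariableChange.mul_def, VariableChange.inv_def, VariableChange.map,
      Units.val_mk0, Units.val_inv_eq_inv_val, Units.val_one, map_one, map_sub, inv_one]
    ring
  have hDt : D.t = algebraMap R (FractionRing R) (t' - t - s * (r' - r)) *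
      (algebraMap R (FractionRing R) ϖ)⁻¹ ^ 3 := by
    rw [hD, hS, hτ, hτ', hp]
    simp only [VariableChange.mul_def, VariableChange.inv_def, VariableChange.map,
      Units.val_mk0, Units.val_inv_eq_inv_val, Units.val_one, map_one, map_sub, map_mul, inv_one]
    ring
  -- AEC VII.1.3 (b): the entries of `D` are integral
  have hr : valuation (FractionRing R) (maximalIdeal R) D.r ≤ 1 :=
    valuation_r_le_one_of_isIntegral R hrel hDu'
  have hs : valuation (FractionRing R) (maximalIdeal R) D.s ≤ 1 :=
    valuation_s_le_one_of_isIntegral R hrel hDu' hr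
  have ht : valuation (FractionRing R) (maximalIdeal R) D.t ≤ 1 :=
    valuation_t_le_one_of_isIntegral R hrel hDu' hr
  obtain ⟨dr, hdr⟩ := exists_lift_of_le_one hr
  obtain ⟨ds, hds⟩ := exists_lift_of_le_one hs
  obtain ⟨dt, hdt⟩ := exists_lift_of_le_one ht
  rw [hDr] at hdr
  rw [hDs] at hds
  rw [hDt] at hdt
  refine ⟨⟨dr, hinj ?_⟩, ⟨ds, hinj ?_⟩, ⟨dt, hinj ?_⟩⟩
  · rw [map_mul, map_pow, hdr]; field_simp
  · rw [map_mul, hds]; field_simp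
  · rw [map_mul, map_pow, hdt]; field_simp

omit [IsDomain R] [IsDiscreteValuationRing R] in
/-- **The witnesses form one coset: the moves.** If `(r, s, t)` is a non-minimality witness of
`M` (`ϖⁱ ∣ aᵢ((1; r, s, t) • M)`), so is `(r + ϖ²ρ, s + ϖσ, t + sϖ²ρ + ϖ³τ)` for all
`ρ, σ, τ ∈ R`: the new translate is `(1; ϖ²ρ, ϖσ, ϖ³τ) • ((1; r, s, t) • M)`, and the
transformation formulas (Silverman, *AEC* III.1 Table 3.1) keep `ϖⁱ ∣ aᵢ`.
[cite: SilvermanAEC2009, III.1 Table 3.1] -/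
theorem witness_move (M : WeierstrassCurve R) (ϖ : R) {r s t : R} (ρ σ τ : R)
    (h1 : ϖ ∣ ((⟨1, r, s, t⟩ : VariableChange R) • M).a₁)
    (h2 : ϖ ^ 2 ∣ ((⟨1, r, s, t⟩ : VariableChange R) • M).a₂)
    (h3 : ϖ ^ 3 ∣ ((⟨1, r, s, t⟩ : VariableChange R) • M).a₃)
    (h4 : ϖ ^ 4 ∣ ((⟨1, r, s, t⟩ : VariableChange R) • M).a₄)
    (h6 : ϖ ^ 6 ∣ ((⟨1, r, s, t⟩ : VariableChange R) • M).a₆) :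
    ϖ ∣ ((⟨1, r + ϖ ^ 2 * ρ, s + ϖ * σ, t + s * ϖ ^ 2 * ρ + ϖ ^ 3 * τ⟩ : VariableChange R) • M).a₁ ∧
    ϖ ^ 2 ∣ ((⟨1, r + ϖ ^ 2 * ρ, s + ϖ * σ, t + s * ϖ ^ 2 * ρ + ϖ ^ 3 * τ⟩ : VariableChange R) •
      M).a₂ ∧
    ϖ ^ 3 ∣ ((⟨1, r + ϖ ^ 2 * ρ, s + ϖ * σ, t + s * ϖ ^ 2 * ρ + ϖ ^ 3 * τ⟩ : VariableChange R) •
      M).a₃ ∧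
    ϖ ^ 4 ∣ ((⟨1, r + ϖ ^ 2 * ρ, s + ϖ * σ, t + s * ϖ ^ 2 * ρ + ϖ ^ 3 * τ⟩ : VariableChange R) •
      M).a₄ ∧
    ϖ ^ 6 ∣ ((⟨1, r + ϖ ^ 2 * ρ, s + ϖ * σ, t + s * ϖ ^ 2 * ρ + ϖ ^ 3 * τ⟩ : VariableChange R) •
      M).a₆ := by
  set N : WeierstrassCurve R := (⟨1, r, s, t⟩ : VariableChange R) • M with hN
  set E : VariableChange R := ⟨1, ϖ ^ 2 * ρ, ϖ * σ, ϖ ^ 3 * τ⟩ with hE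
  have hfac : (⟨1, r + ϖ ^ 2 * ρ, s + ϖ * σ, t + s * ϖ ^ 2 * ρ + ϖ ^ 3 * τ⟩ : VariableChange R) =
      E * ⟨1, r, s, t⟩ := by
    rw [hE, VariableChange.mul_def]
    ext <;> simp <;> ring
  rw [hfac, mul_smul, ← hN]
  obtain ⟨c₁, hc₁⟩ := h1
  obtain ⟨c₂, hc₂⟩ := h2
  obtain ⟨c₃, hc₃⟩ := h3
  obtain ⟨c₄, hc₄⟩ := h4
  obtain ⟨c₆, hc₆⟩ := h6
  refine ⟨⟨c₁ + 2 * σ, ?_⟩, ⟨c₂ - σ * c₁ + 3 * ρ - σ ^ 2, ?_⟩, ⟨c₃ + ρ * c₁ + 2 * τ, ?_⟩,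
    ⟨c₄ - σ * c₃ + 2 * ρ * c₂ - (τ + ρ * σ) * c₁ + 3 * ρ ^ 2 - 2 * σ * τ, ?_⟩,
    ⟨c₆ + ρ * c₄ + ρ ^ 2 * c₂ + ρ ^ 3 - τ * c₃ - τ ^ 2 - ρ * τ * c₁, ?_⟩⟩
  · rw [variableChange_a₁, hE, hc₁]; simp; ring
  · rw [variableChange_a₂, hE, hc₁, hc₂]; simp; ring
  · rw [variableChange_a₃, hE, hc₁, hc₃]; simp; ring
  · rw [variableChange_a₄, hE, hc₁, hc₂, hc₃, hc₄]; simp; ring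
  · rw [variableChange_a₆, hE, hc₁, hc₂, hc₃, hc₄, hc₆]; simp; ring

omit [IsDomain R] [IsDiscreteValuationRing R] in
/-- **The witness set is stable under a ring automorphism fixing the model and the uniformiser.**
If `e` fixes the coefficients of `M` and `e ϖ = ϖ`, then `(r, s, t) ↦ (e r, e s, e t)` maps
non-minimality witnesses to non-minimality witnesses (`aᵢ((1; e r, e s, e t) • M) = e (aᵢ((1; r,
s, t) • M))`, Mathlib `map_variableChange`). [folklore] -/
theorem witness_map (M : WeierstrassCurve R) (e : R ≃+* R) (hM : M.map (e : R →+* R) = M) {ϖ : R}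
    (hϖe : e ϖ = ϖ) {r s t : R}
    (h1 : ϖ ∣ ((⟨1, r, s, t⟩ : VariableChange R) • M).a₁)
    (h2 : ϖ ^ 2 ∣ ((⟨1, r, s, t⟩ : VariableChange R) • M).a₂)
    (h3 : ϖ ^ 3 ∣ ((⟨1, r, s, t⟩ : VariableChange R) • M).a₃)
    (h4 : ϖ ^ 4 ∣ ((⟨1, r, s, t⟩ : VariableChange R) • M).a₄)
    (h6 : ϖ ^ 6 ∣ ((⟨1, r, s, t⟩ : VariableChange R) • M).a₆) :
    ϖ ∣ ((⟨1, e r, e s, e t⟩ : VariableChange R) • M).a₁ ∧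
    ϖ ^ 2 ∣ ((⟨1, e r, e s, e t⟩ : VariableChange R) • M).a₂ ∧
    ϖ ^ 3 ∣ ((⟨1, e r, e s, e t⟩ : VariableChange R) • M).a₃ ∧
    ϖ ^ 4 ∣ ((⟨1, e r, e s, e t⟩ : VariableChange R) • M).a₄ ∧
    ϖ ^ 6 ∣ ((⟨1, e r, e s, e t⟩ : VariableChange R) • M).a₆ := by
  have hmapC : (⟨1, e r, e s, e t⟩ : VariableChange R) =
      (⟨1, r, s, t⟩ : VariableChange R).map (e : R →+* R) := by
    ext <;> simp [VariableChange.map]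
  have heq : (⟨1, e r, e s, e t⟩ : VariableChange R) • M =
      (((⟨1, r, s, t⟩ : VariableChange R) • M).map (e : R →+* R)) := by
    rw [hmapC, ← map_variableChange, hM]
  have hdvd : ∀ (i : ℕ) (x : R), ϖ ^ i ∣ x → ϖ ^ i ∣ e x := fun i x hx ↦ by
    have := map_dvd (e : R →+* R) hx
    rwa [map_pow, RingEquiv.coe_toRingHom, hϖe] at this
  rw [heq]
  simp only [map_a₁, map_a₂, map_a₃, map_a₄, map_a₆, RingEquiv.coe_toRingHom]
  refine ⟨?_, hdvd 2 _ h2, hdvd 3 _ h3, hdvd 4 _ h4, hdvd 6 _ h6⟩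
  simpa using hdvd 1 _ (by simpa using h1)

end Witness

end Summit.BirchSwinnertonDyer.Rank1Residual.X11b.Three.JetchevKummer

end
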